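import Summits.QuantumFields.YangMills.Theorems.FluctuationComparisonRegPrIntLS2BetaSquareRingModulus
import HarnessLib

/-!
# S2β · D-GUARD ∕ (BG∞) — (G7-S) FILE S0: THE SHELL MODULUS OF THE DISCRETE CUBE — per-bond oscillation `η` along the boundary shell of `{0,…,n}³` gives
# `dist1 (φ P·(φ Q)⁻¹) ≤ 2η·|P − Q|₁` for EVERY pair of shell sites: the `ℓ¹`-modulus hypothesis (iii) of S2 ✓∕⧗`…ConeOnCube.exists_coneOnCube` with `lam := 2η`
# (px5 g24's T0 ✓∕⧗`…SquareRingModulus.dist1_boundary_le_two_mul_l1` ONE DIMENSION UP)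

Cell `ym3-torus` (YM ladder rung R3 = continuum `SU(2)` Yang–Mills on the three-torus at fixed lattice data — a RUNG: NOT d = 4, NOT infinite volume,
NOT a mass gap, NOT Clay).  Width seat «width 8» `ym3-torus-px8` (gen 28, toron∕flux lineage ✓p826411 → px17 (W1) ✓p837971), FREE px helper on crux
`stmt-QuantumFields-20520`; `--kind proof --supports stmt-QuantumFields-20520 --as helper`, count-neutral, DEFINITION-FREE (0 `def`, 0 `instance`, 0 `notation`,
0 `sorry`, default heartbeats).  NAMED (G7-S) by px5 g24 (STATUS 2026-09-01T01:21:46Z «(G7-S) IS YOURS, px8»; T0's S-analogue named in px5's T0 SIGNATURE 01:38:05Z) under the architect's conditional GO (px17 g23 01:15:18Z (3)) and desk RULING №127 (P7-D) «binder style».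

WHY.  Stage S of the (BG∞) construction (UV3-NODE §116.3, px19 g25's descent formulation §116 ADD 1) cones the datum on a block's boundary SHELL; S2 states the step bound of
the cone from the datum's `ℓ¹`-MODULUS over the shell, while the glue (G8) delivers PER-BOND letters (adjacent shell sites).  THIS FILE converts the latter into the former
with the constant `2`: two shell sites are joined ON THE SHELL by axis-parallel segments of total length `≤ 2|Δ|₁` — same or other-direction faces: a staircase with at most
one edge turn, length `= |Δ|₁`; opposite faces: around the shorter way through a side face, length `≤ 2n + |Δ_rest| ≤ 2|Δ|₁`.  Generic in the gauge group (`[GaugeGroup G]`,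
only `dist1 (g·k⁻¹) ≤ dist1 (g·h⁻¹) + dist1 (h·k⁻¹)` and `dist1 g⁻¹ = dist1 g` are used).

WHAT IS PROVED (sorry-free; def-free; any `[GaugeGroup G]`; the per-bond letter `hadj` DISPLAYED as a hypothesis: shell sites `P, Q` with `|P − Q|₁ = 1` have
`dist1 (φ P·(φ Q)⁻¹) ≤ η`).
* §1 `le_two_mul_of_path` (path length `ℓ ≤ 2D` ⟹ `ℓη ≤ 2ηD`), `dist1_chain3`, `dist1_chain4` (triangle chains, px19 ✓`dist1_mul_inv_le_via`).
* §2 `dist1_seg1_le`∕`seg2`∕`seg3` and the two-sided `dist1_line1_le`∕`line2`∕`line3`: along a shell LINE in each direction the cost is `≤ (Nat.dist)·η`.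
* §3 ★★ `dist1_shell_le_of_fst` — the modulus when the first site lies on a face of the first direction (four cases: same face ∕ opposite face ∕ `Q` on a face of the second ∕
  of the third direction).
* §4 `hadj_swap12`, `hadj_swap13` (the letter is invariant under coordinate swaps of the datum), ★★★ `dist1_shell_le_two_mul_l1 (n) (φ) (hη : 0 ≤ η) (hadj) (P Q)
  (shell sites) : dist1 (φ P * (φ Q)⁻¹) ≤ 2 * η * ((Nat.dist P.1 Q.1 + Nat.dist P.2.1 Q.2.1 + Nat.dist P.2.2 Q.2.2 : ℕ) : ℝ)` — by swapping the first site onto a face of the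
  first direction.  Its conclusion is S2 (iii)'s `lam`-hypothesis at `lam := 2η`, argument for argument.

HONEST SCOPE.  Elementary lattice bookkeeping; nothing of Bałaban's renormalisation-group analysis is asserted, proved or refuted ([Balaban1985RegularSpaces] Lemma 1 p.79 ∕
Thm 2 p.83: LOCAL axial gauges on cubes — the object the road globalises; consistent, not used); `hBG`∕`hsuppPlus` remains a CONJECTURE under construction; GAP♯∘
(`stub_uniformFibreGapOrbit`; registry v11 3732b7df, v12.1 adopted-in-waiting), the five registered stubs (0∕5), S2β, crux 20520, 19936, 19200, `YM3TorusSU2` are NOT proved;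
no registered stub is closed; rung R3 = `SU(2)` YM₃ on T³ at fixed lattice data — NOT d = 4, NOT infinite volume, NOT a mass gap, NOT Clay; the Yang–Mills mass gap is NOT
proved.  Axioms standard.
References: T. Bałaban, CMP **99** (1985) 75–102 [Balaban1985RegularSpaces] (Lemma 1 p.79, Thm 2 p.83).
-/

set_option autoImplicit false

namespace Summit.QuantumFields.YangMills.Theorems.FluctuationComparisonRegPrIntLS2BetaCubeShellModulus

open Literature.MathematicalPhysics.QuantumFieldTheory.Balaban1983to89
open Summit.QuantumFields.YangMills.Theorems.FluctuationComparisonRegPrIntLS2BetaConeFilling (dist1_mul_inv_le_via)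
open Summit.QuantumFields.YangMills.Theorems.FluctuationComparisonRegPrIntLS2BetaSquareRingModulus (le_two_mul_of_path)

variable {G : Type*} [GaugeGroup G]

/-! ## §1 Chains -/

/-- A chain of three links: `dist1 (φ A·(φ D)⁻¹) ≤` the sum of the three costs. [folklore] -/
theorem dist1_chain3 (φ : ℕ × ℕ × ℕ → G) (A B C D : ℕ × ℕ × ℕ) :
    dist1 (φ A * (φ D)⁻¹) ≤ dist1 (φ A * (φ B)⁻¹) + dist1 (φ B * (φ C)⁻¹) + dist1 (φ C * (φ D)⁻¹) :=
  (dist1_mul_inv_le_via _ _ _).trans (add_le_add (dist1_mul_inv_le_via _ _ _) le_rfl)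

/-- A chain of four links. [folklore] -/
theorem dist1_chain4 (φ : ℕ × ℕ × ℕ → G) (A B C D E : ℕ × ℕ × ℕ) :
    dist1 (φ A * (φ E)⁻¹) ≤ dist1 (φ A * (φ B)⁻¹) + dist1 (φ B * (φ C)⁻¹) + dist1 (φ C * (φ D)⁻¹) + dist1 (φ D * (φ E)⁻¹) :=
  (dist1_mul_inv_le_via _ _ _).trans (add_le_add (dist1_chain3 φ _ _ _ _) le_rfl)

/-! ## §2 Straight shell segments in the three directions -/

section Segments

variable (n : ℕ) (φ : ℕ × ℕ × ℕ → G) {η : ℝ}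
  (hadj : ∀ P Q : ℕ × ℕ × ℕ, P.1 ≤ n → P.2.1 ≤ n → P.2.2 ≤ n →
      (P.1 = 0 ∨ P.1 = n ∨ P.2.1 = 0 ∨ P.2.1 = n ∨ P.2.2 = 0 ∨ P.2.2 = n) →
      Q.1 ≤ n → Q.2.1 ≤ n → Q.2.2 ≤ n →
      (Q.1 = 0 ∨ Q.1 = n ∨ Q.2.1 = 0 ∨ Q.2.1 = n ∨ Q.2.2 = 0 ∨ Q.2.2 = n) →
      Nat.dist P.1 Q.1 + Nat.dist P.2.1 Q.2.1 + Nat.dist P.2.2 Q.2.2 = 1 → dist1 (φ P * (φ Q)⁻¹) ≤ η)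
include hadj

/-- Along a shell LINE in the first direction (`b` or `c` extreme): `dist1 (φ (i,b,c)·(φ (i+d,b,c))⁻¹) ≤ d·η` for `i + d ≤ n`. [folklore] -/
theorem dist1_seg1_le (b c : ℕ) (hb : b ≤ n) (hc : c ≤ n) (hbc : b = 0 ∨ b = n ∨ c = 0 ∨ c = n) (i d : ℕ) (hid : i + d ≤ n) :
    dist1 (φ (i, b, c) * (φ (i + d, b, c))⁻¹) ≤ d * η := by
  induction d with
  | zero => simp [GaugeGroup.dist1_one]
  | succ d ih =>
    have hd : i + d ≤ n := by omega
    have hstep : dist1 (φ (i + d, b, c) * (φ (i + (d + 1), b, c))⁻¹) ≤ η := by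
      refine hadj (i + d, b, c) (i + (d + 1), b, c) hd hb hc (by dsimp only; omega) (by omega) hb hc (by dsimp only; omega) ?_
      simp only [Nat.dist_self, add_zero]
      rw [Nat.dist_eq_sub_of_le (by omega)]; omega
    calc dist1 (φ (i, b, c) * (φ (i + (d + 1), b, c))⁻¹)
        ≤ dist1 (φ (i, b, c) * (φ (i + d, b, c))⁻¹) + dist1 (φ (i + d, b, c) * (φ (i + (d + 1), b, c))⁻¹) := dist1_mul_inv_le_via _ _ _
      _ ≤ d * η + η := add_le_add (ih hd) hstep
      _ = ((d + 1 : ℕ) : ℝ) * η := by push_cast; ring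

/-- Along a shell LINE in the second direction (`a` or `c` extreme). [folklore] -/
theorem dist1_seg2_le (a c : ℕ) (ha : a ≤ n) (hc : c ≤ n) (hac : a = 0 ∨ a = n ∨ c = 0 ∨ c = n) (j d : ℕ) (hjd : j + d ≤ n) :
    dist1 (φ (a, j, c) * (φ (a, j + d, c))⁻¹) ≤ d * η := by
  induction d with
  | zero => simp [GaugeGroup.dist1_one]
  | succ d ih =>
    have hd : j + d ≤ n := by omega
    have hstep : dist1 (φ (a, j + d, c) * (φ (a, j + (d + 1), c))⁻¹) ≤ η := by
      refine hadj (a, j + d, c) (a, j + (d + 1), c) ha hd hc (by dsimp only; omega) ha (by omega) hc (by dsimp only; omega) ?_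
      simp only [Nat.dist_self, add_zero, zero_add]
      rw [Nat.dist_eq_sub_of_le (by omega)]; omega
    calc dist1 (φ (a, j, c) * (φ (a, j + (d + 1), c))⁻¹)
        ≤ dist1 (φ (a, j, c) * (φ (a, j + d, c))⁻¹) + dist1 (φ (a, j + d, c) * (φ (a, j + (d + 1), c))⁻¹) := dist1_mul_inv_le_via _ _ _
      _ ≤ d * η + η := add_le_add (ih hd) hstep
      _ = ((d + 1 : ℕ) : ℝ) * η := by push_cast; ring

/-- Along a shell LINE in the third direction (`a` or `b` extreme). [folklore] -/
theorem dist1_seg3_le (a b : ℕ) (ha : a ≤ n) (hb : b ≤ n) (hab : a = 0 ∨ a = n ∨ b = 0 ∨ b = n) (l d : ℕ) (hld : l + d ≤ n) :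
    dist1 (φ (a, b, l) * (φ (a, b, l + d))⁻¹) ≤ d * η := by
  induction d with
  | zero => simp [GaugeGroup.dist1_one]
  | succ d ih =>
    have hd : l + d ≤ n := by omega
    have hstep : dist1 (φ (a, b, l + d) * (φ (a, b, l + (d + 1)))⁻¹) ≤ η := by
      refine hadj (a, b, l + d) (a, b, l + (d + 1)) ha hb hd (by dsimp only; omega) ha hb (by omega) (by dsimp only; omega) ?_
      simp only [Nat.dist_self, zero_add]
      rw [Nat.dist_eq_sub_of_le (by omega)]; omega
    calc dist1 (φ (a, b, l) * (φ (a, b, l + (d + 1)))⁻¹)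
        ≤ dist1 (φ (a, b, l) * (φ (a, b, l + d))⁻¹) + dist1 (φ (a, b, l + d) * (φ (a, b, l + (d + 1)))⁻¹) := dist1_mul_inv_le_via _ _ _
      _ ≤ d * η + η := add_le_add (ih hd) hstep
      _ = ((d + 1 : ℕ) : ℝ) * η := by push_cast; ring

/-- Two-sided LINE form in the first direction: `dist1 (φ (i₁,b,c)·(φ (i₂,b,c))⁻¹) ≤ (Nat.dist i₁ i₂)·η`. [folklore] -/
theorem dist1_line1_le (b c : ℕ) (hb : b ≤ n) (hc : c ≤ n) (hbc : b = 0 ∨ b = n ∨ c = 0 ∨ c = n) (i₁ i₂ : ℕ) (h₁ : i₁ ≤ n) (h₂ : i₂ ≤ n) :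
    dist1 (φ (i₁, b, c) * (φ (i₂, b, c))⁻¹) ≤ (Nat.dist i₁ i₂ : ℕ) * η := by
  rcases le_total i₁ i₂ with h | h
  · have := dist1_seg1_le n φ hadj b c hb hc hbc i₁ (i₂ - i₁) (by omega)
    rwa [show i₁ + (i₂ - i₁) = i₂ by omega, ← Nat.dist_eq_sub_of_le h] at this
  · have := dist1_seg1_le n φ hadj b c hb hc hbc i₂ (i₁ - i₂) (by omega)
    rw [show i₂ + (i₁ - i₂) = i₁ by omega, ← Nat.dist_eq_sub_of_le_right h] at this
    rwa [← GaugeGroup.dist1_inv, mul_inv_rev, inv_inv]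

/-- Two-sided LINE form in the second direction. [folklore] -/
theorem dist1_line2_le (a c : ℕ) (ha : a ≤ n) (hc : c ≤ n) (hac : a = 0 ∨ a = n ∨ c = 0 ∨ c = n) (j₁ j₂ : ℕ) (h₁ : j₁ ≤ n) (h₂ : j₂ ≤ n) :
    dist1 (φ (a, j₁, c) * (φ (a, j₂, c))⁻¹) ≤ (Nat.dist j₁ j₂ : ℕ) * η := by
  rcases le_total j₁ j₂ with h | h
  · have := dist1_seg2_le n φ hadj a c ha hc hac j₁ (j₂ - j₁) (by omega)
    rwa [show j₁ + (j₂ - j₁) = j₂ by omega, ← Nat.dist_eq_sub_of_le h] at this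
  · have := dist1_seg2_le n φ hadj a c ha hc hac j₂ (j₁ - j₂) (by omega)
    rw [show j₂ + (j₁ - j₂) = j₁ by omega, ← Nat.dist_eq_sub_of_le_right h] at this
    rwa [← GaugeGroup.dist1_inv, mul_inv_rev, inv_inv]

/-- Two-sided LINE form in the third direction. [folklore] -/
theorem dist1_line3_le (a b : ℕ) (ha : a ≤ n) (hb : b ≤ n) (hab : a = 0 ∨ a = n ∨ b = 0 ∨ b = n) (l₁ l₂ : ℕ) (h₁ : l₁ ≤ n) (h₂ : l₂ ≤ n) :
    dist1 (φ (a, b, l₁) * (φ (a, b, l₂))⁻¹) ≤ (Nat.dist l₁ l₂ : ℕ) * η := by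
  rcases le_total l₁ l₂ with h | h
  · have := dist1_seg3_le n φ hadj a b ha hb hab l₁ (l₂ - l₁) (by omega)
    rwa [show l₁ + (l₂ - l₁) = l₂ by omega, ← Nat.dist_eq_sub_of_le h] at this
  · have := dist1_seg3_le n φ hadj a b ha hb hab l₂ (l₁ - l₂) (by omega)
    rw [show l₂ + (l₁ - l₂) = l₁ by omega, ← Nat.dist_eq_sub_of_le_right h] at this
    rwa [← GaugeGroup.dist1_inv, mul_inv_rev, inv_inv]

/-! ## §3 The shell modulus when the first site lies on a face of the first direction -/

/-- ★★ **THE MODULUS FROM A FACE OF THE FIRST DIRECTION**: `P = (p₁, p₂, p₃)` with `p₁ ∈ {0, n}`, `Q` any shell site ⟹ `dist1 (φ P·(φ Q)⁻¹) ≤ 2η·|P − Q|₁`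
(Q on the same face: a staircase inside the face, length `|Δ|₁`; on the opposite face: around the shorter way through a face `x₂ ∈ {0, n}`, length `≤ 2n + |Δ₃| ≤ 2|Δ|₁`; on a
face of another direction: one edge turn, length `|Δ|₁`). [folklore] -/
theorem dist1_shell_le_of_fst (hη : 0 ≤ η) (P Q : ℕ × ℕ × ℕ) (hP1 : P.1 ≤ n) (hP2 : P.2.1 ≤ n) (hP3 : P.2.2 ≤ n)
    (hPf : P.1 = 0 ∨ P.1 = n) (hQ1 : Q.1 ≤ n) (hQ2 : Q.2.1 ≤ n) (hQ3 : Q.2.2 ≤ n)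
    (hQb : Q.1 = 0 ∨ Q.1 = n ∨ Q.2.1 = 0 ∨ Q.2.1 = n ∨ Q.2.2 = 0 ∨ Q.2.2 = n) :
    dist1 (φ P * (φ Q)⁻¹) ≤ 2 * η * ((Nat.dist P.1 Q.1 + Nat.dist P.2.1 Q.2.1 + Nat.dist P.2.2 Q.2.2 : ℕ) : ℝ) := by
  obtain ⟨p1, p2, p3⟩ := P
  obtain ⟨q1, q2, q3⟩ := Q
  simp only at hP1 hP2 hP3 hPf hQ1 hQ2 hQ3 hQb ⊢
  by_cases hQf : q1 = 0 ∨ q1 = n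
  · by_cases heq : p1 = q1
    · -- same face `x₁ = p₁`: staircase `(p1,p2,p3) → (p1,q2,p3) → (p1,q2,q3)`
      subst heq
      have h1 := dist1_line2_le n φ hadj p1 p3 hP1 hP3 (by omega) p2 q2 hP2 hQ2
      have h2 := dist1_line3_le n φ hadj p1 q2 hP1 hQ2 (by omega) p3 q3 hP3 hQ3
      refine le_two_mul_of_path (ℓ := Nat.dist p2 q2 + Nat.dist p3 q3) hη ?_ (by omega)
      calc dist1 (φ (p1, p2, p3) * (φ (p1, q2, q3))⁻¹)
          ≤ dist1 (φ (p1, p2, p3) * (φ (p1, q2, p3))⁻¹) + dist1 (φ (p1, q2, p3) * (φ (p1, q2, q3))⁻¹) := dist1_mul_inv_le_via _ _ _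
        _ ≤ (Nat.dist p2 q2 : ℕ) * η + (Nat.dist p3 q3 : ℕ) * η := add_le_add h1 h2
        _ = ((Nat.dist p2 q2 + Nat.dist p3 q3 : ℕ) : ℝ) * η := by push_cast; ring
    · -- opposite faces: `(p1,p2,p3) → (p1,c,p3) → (q1,c,p3) → (q1,q2,p3) → (q1,q2,q3)` with the shorter side `c ∈ {0, n}`
      have hc : ∃ c, (c = 0 ∨ c = n) ∧
          Nat.dist p2 c + Nat.dist p1 q1 + Nat.dist c q2 + Nat.dist p3 q3 ≤ 2 * (Nat.dist p1 q1 + Nat.dist p2 q2 + Nat.dist p3 q3) := by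
        by_cases hs : p2 + q2 ≤ n
        · exact ⟨0, Or.inl rfl, by unfold Nat.dist; omega⟩
        · exact ⟨n, Or.inr rfl, by unfold Nat.dist; omega⟩
      obtain ⟨c, hcb, hlen⟩ := hc
      have hcn : c ≤ n := by omega
      have h1 := dist1_line2_le n φ hadj p1 p3 hP1 hP3 (by omega) p2 c hP2 hcn
      have h2 := dist1_line1_le n φ hadj c p3 hcn hP3 (by omega) p1 q1 hP1 hQ1
      have h3 := dist1_line2_le n φ hadj q1 p3 hQ1 hP3 (by omega) c q2 hcn hQ2
      have h4 := dist1_line3_le n φ hadj q1 q2 hQ1 hQ2 (by omega) p3 q3 hP3 hQ3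
      refine le_two_mul_of_path hη ?_ hlen
      calc dist1 (φ (p1, p2, p3) * (φ (q1, q2, q3))⁻¹)
          ≤ dist1 (φ (p1, p2, p3) * (φ (p1, c, p3))⁻¹) + dist1 (φ (p1, c, p3) * (φ (q1, c, p3))⁻¹)
            + dist1 (φ (q1, c, p3) * (φ (q1, q2, p3))⁻¹) + dist1 (φ (q1, q2, p3) * (φ (q1, q2, q3))⁻¹) := dist1_chain4 φ _ _ _ _ _
        _ ≤ (Nat.dist p2 c : ℕ) * η + (Nat.dist p1 q1 : ℕ) * η + (Nat.dist c q2 : ℕ) * η + (Nat.dist p3 q3 : ℕ) * η :=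
            add_le_add (add_le_add (add_le_add h1 h2) h3) h4
        _ = ((Nat.dist p2 c + Nat.dist p1 q1 + Nat.dist c q2 + Nat.dist p3 q3 : ℕ) : ℝ) * η := by push_cast; ring
  · by_cases hQg : q2 = 0 ∨ q2 = n
    · -- `Q` on a face of the second direction: `(p1,p2,p3) → (p1,q2,p3) → (p1,q2,q3) → (q1,q2,q3)` (edge `x₁ = p₁, x₂ = q₂`)
      have h1 := dist1_line2_le n φ hadj p1 p3 hP1 hP3 (by omega) p2 q2 hP2 hQ2
      have h2 := dist1_line3_le n φ hadj p1 q2 hP1 hQ2 (by omega) p3 q3 hP3 hQ3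
      have h3 := dist1_line1_le n φ hadj q2 q3 hQ2 hQ3 (by omega) p1 q1 hP1 hQ1
      refine le_two_mul_of_path (ℓ := Nat.dist p2 q2 + Nat.dist p3 q3 + Nat.dist p1 q1) hη ?_ (by omega)
      calc dist1 (φ (p1, p2, p3) * (φ (q1, q2, q3))⁻¹)
          ≤ dist1 (φ (p1, p2, p3) * (φ (p1, q2, p3))⁻¹) + dist1 (φ (p1, q2, p3) * (φ (p1, q2, q3))⁻¹)
            + dist1 (φ (p1, q2, q3) * (φ (q1, q2, q3))⁻¹) := dist1_chain3 φ _ _ _ _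
        _ ≤ (Nat.dist p2 q2 : ℕ) * η + (Nat.dist p3 q3 : ℕ) * η + (Nat.dist p1 q1 : ℕ) * η := add_le_add (add_le_add h1 h2) h3
        _ = ((Nat.dist p2 q2 + Nat.dist p3 q3 + Nat.dist p1 q1 : ℕ) : ℝ) * η := by push_cast; ring
    · -- `Q` on a face of the third direction: `(p1,p2,p3) → (p1,p2,q3) → (p1,q2,q3) → (q1,q2,q3)` (edge `x₁ = p₁, x₃ = q₃`)
      have hQh : q3 = 0 ∨ q3 = n := by omega
      have h1 := dist1_line3_le n φ hadj p1 p2 hP1 hP2 (by omega) p3 q3 hP3 hQ3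
      have h2 := dist1_line2_le n φ hadj p1 q3 hP1 hQ3 (by omega) p2 q2 hP2 hQ2
      have h3 := dist1_line1_le n φ hadj q2 q3 hQ2 hQ3 (by omega) p1 q1 hP1 hQ1
      refine le_two_mul_of_path (ℓ := Nat.dist p3 q3 + Nat.dist p2 q2 + Nat.dist p1 q1) hη ?_ (by omega)
      calc dist1 (φ (p1, p2, p3) * (φ (q1, q2, q3))⁻¹)
          ≤ dist1 (φ (p1, p2, p3) * (φ (p1, p2, q3))⁻¹) + dist1 (φ (p1, p2, q3) * (φ (p1, q2, q3))⁻¹)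
            + dist1 (φ (p1, q2, q3) * (φ (q1, q2, q3))⁻¹) := dist1_chain3 φ _ _ _ _
        _ ≤ (Nat.dist p3 q3 : ℕ) * η + (Nat.dist p2 q2 : ℕ) * η + (Nat.dist p1 q1 : ℕ) * η := add_le_add (add_le_add h1 h2) h3
        _ = ((Nat.dist p3 q3 + Nat.dist p2 q2 + Nat.dist p1 q1 : ℕ) : ℝ) * η := by push_cast; ring

end Segments

/-! ## §4 The shell modulus, by transport of coordinates -/

/-- The per-bond shell letter is invariant under swapping the first two coordinates of the datum. [folklore] -/
theorem hadj_swap12 (n : ℕ) (φ : ℕ × ℕ × ℕ → G) {η : ℝ}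
    (hadj : ∀ P Q : ℕ × ℕ × ℕ, P.1 ≤ n → P.2.1 ≤ n → P.2.2 ≤ n →
      (P.1 = 0 ∨ P.1 = n ∨ P.2.1 = 0 ∨ P.2.1 = n ∨ P.2.2 = 0 ∨ P.2.2 = n) →
      Q.1 ≤ n → Q.2.1 ≤ n → Q.2.2 ≤ n →
      (Q.1 = 0 ∨ Q.1 = n ∨ Q.2.1 = 0 ∨ Q.2.1 = n ∨ Q.2.2 = 0 ∨ Q.2.2 = n) →
      Nat.dist P.1 Q.1 + Nat.dist P.2.1 Q.2.1 + Nat.dist P.2.2 Q.2.2 = 1 → dist1 (φ P * (φ Q)⁻¹) ≤ η) :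
    ∀ P Q : ℕ × ℕ × ℕ, P.1 ≤ n → P.2.1 ≤ n → P.2.2 ≤ n →
      (P.1 = 0 ∨ P.1 = n ∨ P.2.1 = 0 ∨ P.2.1 = n ∨ P.2.2 = 0 ∨ P.2.2 = n) →
      Q.1 ≤ n → Q.2.1 ≤ n → Q.2.2 ≤ n →
      (Q.1 = 0 ∨ Q.1 = n ∨ Q.2.1 = 0 ∨ Q.2.1 = n ∨ Q.2.2 = 0 ∨ Q.2.2 = n) →
      Nat.dist P.1 Q.1 + Nat.dist P.2.1 Q.2.1 + Nat.dist P.2.2 Q.2.2 = 1 →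
      dist1 ((fun x : ℕ × ℕ × ℕ => φ (x.2.1, x.1, x.2.2)) P * ((fun x : ℕ × ℕ × ℕ => φ (x.2.1, x.1, x.2.2)) Q)⁻¹) ≤ η := by
  intro P Q hP1 hP2 hP3 hPb hQ1 hQ2 hQ3 hQb hd
  exact hadj (P.2.1, P.1, P.2.2) (Q.2.1, Q.1, Q.2.2) hP2 hP1 hP3 (by dsimp only; omega) hQ2 hQ1 hQ3 (by dsimp only; omega)
    (by dsimp only; omega)

/-- The per-bond shell letter is invariant under swapping the first and third coordinates of the datum. [folklore] -/
theorem hadj_swap13 (n : ℕ) (φ : ℕ × ℕ × ℕ → G) {η : ℝ}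
    (hadj : ∀ P Q : ℕ × ℕ × ℕ, P.1 ≤ n → P.2.1 ≤ n → P.2.2 ≤ n →
      (P.1 = 0 ∨ P.1 = n ∨ P.2.1 = 0 ∨ P.2.1 = n ∨ P.2.2 = 0 ∨ P.2.2 = n) →
      Q.1 ≤ n → Q.2.1 ≤ n → Q.2.2 ≤ n →
      (Q.1 = 0 ∨ Q.1 = n ∨ Q.2.1 = 0 ∨ Q.2.1 = n ∨ Q.2.2 = 0 ∨ Q.2.2 = n) →
      Nat.dist P.1 Q.1 + Nat.dist P.2.1 Q.2.1 + Nat.dist P.2.2 Q.2.2 = 1 → dist1 (φ P * (φ Q)⁻¹) ≤ η) :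
    ∀ P Q : ℕ × ℕ × ℕ, P.1 ≤ n → P.2.1 ≤ n → P.2.2 ≤ n →
      (P.1 = 0 ∨ P.1 = n ∨ P.2.1 = 0 ∨ P.2.1 = n ∨ P.2.2 = 0 ∨ P.2.2 = n) →
      Q.1 ≤ n → Q.2.1 ≤ n → Q.2.2 ≤ n →
      (Q.1 = 0 ∨ Q.1 = n ∨ Q.2.1 = 0 ∨ Q.2.1 = n ∨ Q.2.2 = 0 ∨ Q.2.2 = n) →
      Nat.dist P.1 Q.1 + Nat.dist P.2.1 Q.2.1 + Nat.dist P.2.2 Q.2.2 = 1 →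
      dist1 ((fun x : ℕ × ℕ × ℕ => φ (x.2.2, x.2.1, x.1)) P * ((fun x : ℕ × ℕ × ℕ => φ (x.2.2, x.2.1, x.1)) Q)⁻¹) ≤ η := by
  intro P Q hP1 hP2 hP3 hPb hQ1 hQ2 hQ3 hQb hd
  exact hadj (P.2.2, P.2.1, P.1) (Q.2.2, Q.2.1, Q.1) hP3 hP2 hP1 (by dsimp only; omega) hQ3 hQ2 hQ1 (by dsimp only; omega)
    (by dsimp only; omega)

/-- ★★★ **THE SHELL MODULUS OF THE DISCRETE CUBE**: per-bond oscillation `η` along the boundary shell of `{0..n}³` (shell sites at `ℓ¹`-distance `1`) gives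
`dist1 (φ P · (φ Q)⁻¹) ≤ 2η·|P − Q|₁` for EVERY pair of shell sites — the `ℓ¹`-modulus hypothesis (iii) of S2 ✓∕⧗`…ConeOnCube.exists_coneOnCube` with `lam := 2η`
(px5's T0 ✓∕⧗`…SquareRingModulus.dist1_boundary_le_two_mul_l1` one dimension up: same∕other-direction faces — a staircase with one edge turn, length `|Δ|₁`; opposite faces —
around the shorter way, length `≤ 2|Δ|₁`; the first site is brought to a face of the first direction by a coordinate swap of the datum). [folklore] -/
theorem dist1_shell_le_two_mul_l1 (n : ℕ) (φ : ℕ × ℕ × ℕ → G) {η : ℝ} (hη : 0 ≤ η)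
    (hadj : ∀ P Q : ℕ × ℕ × ℕ, P.1 ≤ n → P.2.1 ≤ n → P.2.2 ≤ n →
      (P.1 = 0 ∨ P.1 = n ∨ P.2.1 = 0 ∨ P.2.1 = n ∨ P.2.2 = 0 ∨ P.2.2 = n) →
      Q.1 ≤ n → Q.2.1 ≤ n → Q.2.2 ≤ n →
      (Q.1 = 0 ∨ Q.1 = n ∨ Q.2.1 = 0 ∨ Q.2.1 = n ∨ Q.2.2 = 0 ∨ Q.2.2 = n) →
      Nat.dist P.1 Q.1 + Nat.dist P.2.1 Q.2.1 + Nat.dist P.2.2 Q.2.2 = 1 → dist1 (φ P * (φ Q)⁻¹) ≤ η)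
    (P Q : ℕ × ℕ × ℕ) (hP1 : P.1 ≤ n) (hP2 : P.2.1 ≤ n) (hP3 : P.2.2 ≤ n)
    (hPb : P.1 = 0 ∨ P.1 = n ∨ P.2.1 = 0 ∨ P.2.1 = n ∨ P.2.2 = 0 ∨ P.2.2 = n)
    (hQ1 : Q.1 ≤ n) (hQ2 : Q.2.1 ≤ n) (hQ3 : Q.2.2 ≤ n)
    (hQb : Q.1 = 0 ∨ Q.1 = n ∨ Q.2.1 = 0 ∨ Q.2.1 = n ∨ Q.2.2 = 0 ∨ Q.2.2 = n) :
    dist1 (φ P * (φ Q)⁻¹) ≤ 2 * η * ((Nat.dist P.1 Q.1 + Nat.dist P.2.1 Q.2.1 + Nat.dist P.2.2 Q.2.2 : ℕ) : ℝ) := by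
  by_cases h1 : P.1 = 0 ∨ P.1 = n
  · exact dist1_shell_le_of_fst n φ hadj hη P Q hP1 hP2 hP3 h1 hQ1 hQ2 hQ3 hQb
  by_cases h2 : P.2.1 = 0 ∨ P.2.1 = n
  · -- swap the first two coordinates
    have h := dist1_shell_le_of_fst n (fun x : ℕ × ℕ × ℕ => φ (x.2.1, x.1, x.2.2)) (hadj_swap12 n φ hadj) hη
      (P.2.1, P.1, P.2.2) (Q.2.1, Q.1, Q.2.2) hP2 hP1 hP3 h2 hQ2 hQ1 hQ3 (by dsimp only; omega)
    simp only at h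
    calc dist1 (φ P * (φ Q)⁻¹) = dist1 (φ (P.1, P.2.1, P.2.2) * (φ (Q.1, Q.2.1, Q.2.2))⁻¹) := rfl
      _ ≤ 2 * η * ((Nat.dist P.2.1 Q.2.1 + Nat.dist P.1 Q.1 + Nat.dist P.2.2 Q.2.2 : ℕ) : ℝ) := h
      _ = 2 * η * ((Nat.dist P.1 Q.1 + Nat.dist P.2.1 Q.2.1 + Nat.dist P.2.2 Q.2.2 : ℕ) : ℝ) := by
          rw [Nat.add_comm (Nat.dist P.2.1 Q.2.1) (Nat.dist P.1 Q.1)]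
  · -- swap the first and third coordinates
    have h3 : P.2.2 = 0 ∨ P.2.2 = n := by omega
    have h := dist1_shell_le_of_fst n (fun x : ℕ × ℕ × ℕ => φ (x.2.2, x.2.1, x.1)) (hadj_swap13 n φ hadj) hη
      (P.2.2, P.2.1, P.1) (Q.2.2, Q.2.1, Q.1) hP3 hP2 hP1 h3 hQ3 hQ2 hQ1 (by dsimp only; omega)
    simp only at h
    calc dist1 (φ P * (φ Q)⁻¹) = dist1 (φ (P.1, P.2.1, P.2.2) * (φ (Q.1, Q.2.1, Q.2.2))⁻¹) := rfl
      _ ≤ 2 * η * ((Nat.dist P.2.2 Q.2.2 + Nat.dist P.2.1 Q.2.1 + Nat.dist P.1 Q.1 : ℕ) : ℝ) := h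
      _ = 2 * η * ((Nat.dist P.1 Q.1 + Nat.dist P.2.1 Q.2.1 + Nat.dist P.2.2 Q.2.2 : ℕ) : ℝ) := by
          rw [show Nat.dist P.2.2 Q.2.2 + Nat.dist P.2.1 Q.2.1 + Nat.dist P.1 Q.1
              = Nat.dist P.1 Q.1 + Nat.dist P.2.1 Q.2.1 + Nat.dist P.2.2 Q.2.2 by omega]

end Summit.QuantumFields.YangMills.Theorems.FluctuationComparisonRegPrIntLS2BetaCubeShellModulus
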